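import Mathlib

/-!
# SoloBlind — Young absorption: the real-number skeleton of the closing step of paper §24.13

In the three-multiplier estimate for the linearised forced-carrier operator
(HOME `paper/steady-zeroth-law.md` §24.13, CLOSING IN FULL) the viscous cross term of the leaf
pairing (M3) is bounded, after interpolation, by `c * a^3 * b` with `a^4 = ν‖∇ζ‖²`,
`b^4 = ‖ζ₀‖²` (leaf part in `H⁻¹`) and a SMALL coefficient `c = C ν^{1/4}`.  The estimate closes
because such a term is absorbed: `b^4 ≤ A + c a^3 b` with `0 ≤ c ≤ 1` forces
`b^4 ≤ (4/3) A + c a^4` — smallness of `c` survives in front of `a^4`, which is what the energy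
pairing (M1) can pay for.  With Poincaré instead of interpolation one would face `c = O(1)` and
no absorption (`absorb_of_one_le` shows the price: the coefficient becomes `c^2`).
Only these elementary real inequalities are formalised here (a (3,1)-weighted AM–GM, its two
scalings, and the two absorption statements); no analysis.
-/

namespace Summit.AnomalousDissipation.AnomalousDissipation.Theorems

/-- (3,1)-weighted AM–GM: `4 a³ b ≤ 3 a⁴ + b⁴`, from `3a⁴ + b⁴ − 4a³b = (a − b)² (2a² + (a + b)²)`. -/
theorem four_mul_cube_mul_le (a b : ℝ) : 4 * a ^ 3 * b ≤ 3 * a ^ 4 + b ^ 4 := by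
  have h : 0 ≤ (a - b) ^ 2 * (2 * a ^ 2 + (a + b) ^ 2) := by positivity
  have e : (a - b) ^ 2 * (2 * a ^ 2 + (a + b) ^ 2) = 3 * a ^ 4 + b ^ 4 - 4 * a ^ 3 * b := by
    ring
  rw [e] at h
  linarith

/-- First scaling (weight on `b`): `4 k · a³ b ≤ 3 a⁴ + k⁴ b⁴` for every real `k`. -/
theorem cube_mul_le_scaled_right (a b k : ℝ) :
    4 * k * (a ^ 3 * b) ≤ 3 * a ^ 4 + k ^ 4 * b ^ 4 := by
  have h := four_mul_cube_mul_le a (k * b)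
  calc 4 * k * (a ^ 3 * b) = 4 * a ^ 3 * (k * b) := by ring
    _ ≤ 3 * a ^ 4 + (k * b) ^ 4 := h
    _ = 3 * a ^ 4 + k ^ 4 * b ^ 4 := by ring

/-- Second scaling (weight on `a`): `4 k³ · a³ b ≤ 3 k⁴ a⁴ + b⁴` for every real `k`. -/
theorem cube_mul_le_scaled_left (a b k : ℝ) :
    4 * k ^ 3 * (a ^ 3 * b) ≤ 3 * k ^ 4 * a ^ 4 + b ^ 4 := by
  have h := four_mul_cube_mul_le (k * a) b
  calc 4 * k ^ 3 * (a ^ 3 * b) = 4 * (k * a) ^ 3 * b := by ring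
    _ ≤ 3 * (k * a) ^ 4 + b ^ 4 := h
    _ = 3 * k ^ 4 * a ^ 4 + b ^ 4 := by ring

/-- ABSORPTION with a small coefficient (the case used in §24.13, `c = C ν^{1/4} ≤ 1`):
`b⁴ ≤ A + c a³ b` and `0 ≤ c ≤ 1` imply `b⁴ ≤ (4/3) A + c a⁴`. -/
theorem absorb_of_le_one {a b A c : ℝ} (hc0 : 0 ≤ c) (hc1 : c ≤ 1)
    (h : b ^ 4 ≤ A + c * a ^ 3 * b) : b ^ 4 ≤ 4 / 3 * A + c * a ^ 4 := by
  have h1 := four_mul_cube_mul_le a b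
  have hb4 : 0 ≤ b ^ 4 := by positivity
  have h3 : c * (4 * a ^ 3 * b) ≤ c * (3 * a ^ 4 + b ^ 4) := mul_le_mul_of_nonneg_left h1 hc0
  have h4 : c * b ^ 4 ≤ 1 * b ^ 4 := mul_le_mul_of_nonneg_right hc1 hb4
  nlinarith [h3, h4, h]

/-- ABSORPTION with a large coefficient (what Poincaré alone would give): `b⁴ ≤ A + c a³ b` and
`1 ≤ c` imply only `b⁴ ≤ (4/3) A + c² a⁴` — the coefficient in front of `a⁴` is no longer small. -/
theorem absorb_of_one_le {a b A c : ℝ} (hc1 : 1 ≤ c)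
    (h : b ^ 4 ≤ A + c * a ^ 3 * b) : b ^ 4 ≤ 4 / 3 * A + c ^ 2 * a ^ 4 := by
  have hc : 0 < c := by linarith
  have h1 := cube_mul_le_scaled_left a b c
  have hb4 : 0 ≤ b ^ 4 := by positivity
  have hc2 : 0 ≤ c ^ 2 - 1 := by nlinarith
  have h2 : c ^ 2 * (4 * (c * a ^ 3 * b)) ≤ c ^ 2 * (3 * c ^ 2 * a ^ 4 + b ^ 4) := by
    nlinarith [h1, mul_nonneg hc2 hb4]
  have h3 : 4 * (c * a ^ 3 * b) ≤ 3 * c ^ 2 * a ^ 4 + b ^ 4 :=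
    le_of_mul_le_mul_left h2 (by positivity)
  linarith

/-- The form quoted in §24.13: if the squared leaf norm `N = b⁴`, the scaled Dirichlet term
`D = a⁴` and data `A` satisfy `N ≤ A + c · D^{3/4} N^{1/4}` with `0 ≤ c ≤ 1` — written without real
powers as `b⁴ ≤ A + c a³ b` for `a, b ≥ 0` — then `N ≤ (4/3) A + c D`; and the bound is monotone in
the data. -/
theorem leaf_norm_absorb {a b A A' c : ℝ} (hc0 : 0 ≤ c) (hc1 : c ≤ 1) (hAA' : A ≤ A')
    (h : b ^ 4 ≤ A + c * a ^ 3 * b) : b ^ 4 ≤ 4 / 3 * A' + c * a ^ 4 := by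
  have := absorb_of_le_one hc0 hc1 h
  linarith

end Summit.AnomalousDissipation.AnomalousDissipation.Theorems
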